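import Summits.CriticalPhenomena.PercolationContinuityZ3.Theorems.PercNearOneGluingNoHeavyRsw3FarVolumePigeonhole
import HarnessLib

/-!
# RSW3 lane (P2, gen 20): the FAR-CONNECTED VOLUME of a box, III′ — pigeonhole and re-rooting over the crossing clusters of a GENERAL
# annulus `Λ(N) ∖ Λ(a)` (`N ≥ 2a`): the count hypothesis may be placed at ANY aspect (every `p`)

builds on p205010 (kernel theorem, internal audit signed; external expert review pending) — NOT used in this file.

Cell `prim-rsw3`, prover seat `prim-rsw3-p2` (gen 20), memo `run/shared/lean/prim/rsw3/P2-RSWLITE.md` §27.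
Support file (`--supports stmt-CriticalPhenomena-4575`); no definitions, no named facts, no sorries.

The aspect-free form of `…Rsw3FarVolumePigeonhole.lean` (which is the case `N = 2a`).  The clusters are those of `Λ(N)` meeting `Λ(a)` and
`∂ⁱⁿΛ(N)` (`Crossing.annulusClusterCount d a N`), the class relation is '`↔ in Λ(N)`', the fat event is `FAT(z, N, t)` (certified inside
`Λ_z(4N)`), and the arms have radius `M ≥ N + a`.  The point: the tightness of `N(n, Cn)` for a LARGE aspect `C` is a weaker hypothesis
than at aspect `2` (fewer clusters cross a thicker annulus), and it follows by BK from ANY uniform annulus-blocking bound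
`sup_n P_{p_c}(Λ(n) ↔ ∂ⁱⁿΛ(Cn)) < 1` (the weakest RSW-upper input; `…Rsw3FarVolumeCriticalAspect.lean`).

* `exists_openConnIn_innerBoundary_of_armEvent_of_le`, `card_filter_le_mul_card_class_of_le` (PIGEONHOLE at aspect `N/a`),
  `filter_class_subset_fat_of_le`, `le_card_filter_armEvent_inter_fat_of_le`,
* **`mul_le_card_mul_real_siteToBoundary_inter_fat_of_le`** — RE-ROOTING:
  `(|Λ(a)|π_p(M)/(2k))·(P_p(½|Λ(a)|π_p(M) < Z_a) − P_p(k < N(a,N))) ≤ |Λ(a)|·P_p({0 ↔ ∂ⁱⁿΛ(M)} ∩ FAT(0, N, |Λ(a)|π_p(M)/(2k)))`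
  (`1 ≤ a`, `2a ≤ N`, `N + a ≤ M`, `1 ≤ k`).

References: H. Kesten, Probab. Theory Relat. Fields 73 (1986), Thm. (8) [Kesten1986]; M. Aizenman, Nucl. Phys. B 485 (1997) §5
[Aizenman1997]; C. Borgs, J. Chayes, H. Kesten, J. Spencer, Random Structures Algorithms 15 (1999) §1 [BorgsChayesKestenSpencer1999]. [folklore]
-/

noncomputable section

namespace Summit.CriticalPhenomena.PercolationContinuityZ3.Theorems

namespace Rsw3

open MeasureTheory Literature.Probability.LatticeModels Literature.Probability.Percolation
open SurfaceTension Crossing SimpleGraph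
open scoped Literature.Probability.Percolation

variable {d : ℕ}

/-! ## §1 An arm at `v ∈ Λ(a)` crosses the annulus `Λ(N) ∖ Λ(a)` -/

/-- **An arm at `v ∈ Λ(a)` of radius `M ≥ N + a` crosses `Λ(N) ∖ Λ(a)` inside `Λ(N)`** (lattice configurations; `1 ≤ a`, `2a ≤ N`): stop the arm at
its first exit from `Λ(N−1)`. [folklore] -/
theorem exists_openConnIn_innerBoundary_of_armEvent_of_le {a N M : ℕ} (ha : 1 ≤ a) (haN : 2 * a ≤ N) (haM : N + a ≤ M) {v : Site d}
    (hv : v ∈ box d a) {ω : BondConfig (Site d)} (hω : ω ⊆ (zdGraph d).edgeSet) (h : ω ∈ DCT16.armEvent v M) :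
    ∃ y ∈ innerBoundary (zdGraph d) (box d N), ω ∈ openConnIn (↑(box d N) : Set (Site d)) v y := by
  obtain ⟨t, ht, hvt⟩ := h
  rw [DCT16.mem_openConnIn_iff_pathIn] at hvt
  set R : Set (Site d) := ↑(box d (N - 1)) with hR
  have hvR : v ∈ R := Finset.mem_coe.2 (box_mono d (by omega) hv)
  have htR : t ∉ R := by
    intro htR
    obtain ⟨i, hi⟩ := DCT16.exists_natAbs_eq_of_mem_innerBoundary_box ht
    have h1 := (mem_box.1 (Finset.mem_coe.1 htR)) i
    have h2 := (mem_box.1 hv) i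
    simp only [Pi.sub_apply] at hi
    omega
  obtain ⟨a', b, ha', hb, -, hab, hpath⟩ := hvt.exit hvR htR
  have hb2 : b ∈ box d N := by
    have h := DCT16.mem_box_succ_of_adj (Finset.mem_coe.1 ha') (DCT16.adj_of_openGraph_adj hω hab)
    rwa [show N - 1 + 1 = N by omega] at h
  have hbbd : b ∈ innerBoundary (zdGraph d) (box d N) := by
    have hb' : b ∉ box d (N - 1) := fun h' => hb (Finset.mem_coe.2 h')
    rw [mem_box] at hb' hb2
    push Not at hb'
    obtain ⟨i, hi⟩ := hb'
    have h2 := hb2 i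
    refine DCT16.mem_innerBoundary_box_of_natAbs_eq (mem_box.2 hb2) (i := i) ?_
    by_cases hle : -((N - 1 : ℕ) : ℤ) ≤ b i
    · have := hi hle; omega
    · omega
  refine ⟨b, hbbd, DCT16.mem_openConnIn_of_pathIn ?_⟩
  have hpath' : PathIn (openGraph ω) (↑(box d N) : Set (Site d)) v a' :=
    hpath.mono (Set.inter_subset_left.trans (Finset.coe_subset.2 (box_mono d (by omega))))
  exact hpath'.tail hab (Finset.mem_coe.2 hb2)

/-! ## §2 Pigeonhole over the crossing clusters -/

open Classical in
/-- **PIGEONHOLE OVER THE CROSSING CLUSTERS OF `Λ(N) ∖ Λ(a)`** (lattice configurations; `1 ≤ a`, `2a ≤ N`, `N + a ≤ M`).  If at most `k` open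
clusters of `Λ(N)` meet both `Λ(a)` and `∂ⁱⁿΛ(N)` (`annulusClusterCount d a N ≤ k`) and `G = {v ∈ Λ(a) : armEvent v M}` is non-empty, then some
`v ∈ G` has `#G ≤ k · #{z ∈ G : v ↔ z in Λ(N)}`. [cite: Aizenman1997, §5 (spanning clusters)] -/
theorem card_filter_le_mul_card_class_of_le {a N M k : ℕ} (ha : 1 ≤ a) (haN : 2 * a ≤ N) (haM : N + a ≤ M) {ω : BondConfig (Site d)}
    (hω : ω ⊆ (zdGraph d).edgeSet) (hN : annulusClusterCount d a N ω ≤ k)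
    (hG : ((box d a).filter fun v => ω ∈ DCT16.armEvent v M).Nonempty) :
    ∃ v ∈ (box d a).filter (fun v => ω ∈ DCT16.armEvent v M),
      ((box d a).filter fun v => ω ∈ DCT16.armEvent v M).card ≤
        k * (((box d a).filter fun v => ω ∈ DCT16.armEvent v M).filter fun z =>
          ω ∈ openConnIn (↑(box d N) : Set (Site d)) v z).card := by
  classical
  set S : Set (Site d) := ↑(box d N) with hS
  set G' : SimpleGraph S := (openGraph ω).induce S with hG'
  set G := (box d a).filter fun v => ω ∈ DCT16.armEvent v M with hGdef
  set good : Set G'.ConnectedComponent :=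
    {C | (∃ x : S, (x : Site d) ∈ box d a ∧ x ∈ C.supp) ∧
      ∃ y : S, (y : Site d) ∈ innerBoundary (zdGraph d) (box d N) ∧ y ∈ C.supp} with hgood
  have hgoodN : good.encard = annulusClusterCount d a N ω := rfl
  have h0S : (0 : Site d) ∈ S := Finset.mem_coe.2 (zero_mem_box d _)
  -- the component map
  set f : Site d → G'.ConnectedComponent := fun v =>
    if h : v ∈ S then G'.connectedComponentMk ⟨v, h⟩ else G'.connectedComponentMk ⟨0, h0S⟩ with hf
  have hGS : ∀ v ∈ G, v ∈ S := fun v hv =>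
    Finset.mem_coe.2 (box_mono d (by omega) (Finset.mem_filter.1 hv).1)
  have hfv : ∀ v (h : v ∈ S), f v = G'.connectedComponentMk ⟨v, h⟩ := fun v h => by rw [hf]; exact dif_pos h
  -- `f` maps `G` into the good components
  have hfin : good.Finite := Set.finite_of_encard_le_coe hN
  set T : Finset G'.ConnectedComponent := hfin.toFinset with hT
  have hTcard : T.card ≤ k := by
    have hN' : good.encard ≤ k := hN
    rw [hfin.encard_eq_coe_toFinset_card] at hN'
    exact_mod_cast hN'
  have hmaps : ∀ v ∈ G, f v ∈ T := by
    intro v hv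
    rw [hT, Set.Finite.mem_toFinset]
    have hvS := hGS v hv
    obtain ⟨hva, hvarm⟩ := Finset.mem_filter.1 hv
    obtain ⟨y, hy, hvy⟩ := exists_openConnIn_innerBoundary_of_armEvent_of_le ha haN haM hva hω hvarm
    obtain ⟨hvS', hyS, hreach⟩ := hvy
    rw [hfv v hvS]
    refine ⟨⟨⟨v, hvS⟩, hva, ?_⟩, ⟨⟨y, hyS⟩, hy, ?_⟩⟩
    · rw [SimpleGraph.ConnectedComponent.mem_supp_iff]
    · rw [SimpleGraph.ConnectedComponent.mem_supp_iff]
      exact (SimpleGraph.ConnectedComponent.sound hreach).symm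
  -- pigeonhole: the largest fibre
  have hTne : T.Nonempty := by
    obtain ⟨v, hv⟩ := hG
    exact ⟨f v, hmaps v hv⟩
  obtain ⟨C, hCT, hCmax⟩ := Finset.exists_max_image T (fun C => (G.filter fun z => f z = C).card) hTne
  have hsum : G.card = ∑ C' ∈ T, (G.filter fun z => f z = C').card := Finset.card_eq_sum_card_fiberwise hmaps
  have hle : G.card ≤ T.card * (G.filter fun z => f z = C).card := by
    rw [hsum]
    have h := Finset.sum_le_card_nsmul T (fun C' => (G.filter fun z => f z = C').card) _ hCmax
    simpa using h
  -- the largest fibre is non-empty; pick `v` in it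
  have hfib : (G.filter fun z => f z = C).Nonempty := by
    rw [Finset.nonempty_iff_ne_empty]
    intro hempty
    rw [hempty, Finset.card_empty, mul_zero] at hle
    exact absurd (Finset.card_pos.2 hG) (by omega)
  obtain ⟨v, hv⟩ := hfib
  obtain ⟨hvG, hfvC⟩ := Finset.mem_filter.1 hv
  have hvS := hGS v hvG
  refine ⟨v, hvG, hle.trans ?_⟩
  refine (Nat.mul_le_mul_left _ (Finset.card_le_card ?_)).trans (Nat.mul_le_mul_right _ hTcard)
  intro z hz
  obtain ⟨hzG, hfzC⟩ := Finset.mem_filter.1 hz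
  have hzS := hGS z hzG
  refine Finset.mem_filter.2 ⟨hzG, hvS, hzS, ?_⟩
  have h1 : G'.connectedComponentMk ⟨v, hvS⟩ = G'.connectedComponentMk ⟨z, hzS⟩ := by
    rw [← hfv v hvS, ← hfv z hzS, hfvC, hfzC]
  exact SimpleGraph.ConnectedComponent.exact h1

/-! ## §3 The members of a class are fat and have arms -/

open Classical in
/-- **A class of '`↔ in Λ(N)`' inside `Λ(a)` is seen from each of its members** (`2a ≤ N`): if `z ∈ Λ(a)` and `v ↔ z in Λ(N)`, then every
`z' ∈ Λ(a)` with `v ↔ z' in Λ(N)` lies in `Λ_z(N)` and is joined to `z` inside `Λ_z(4N)`. [folklore] -/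
theorem filter_class_subset_fat_of_le {a N : ℕ} (haN : 2 * a ≤ N) (G : Finset (Site d)) (hGa : G ⊆ box d a) {v z : Site d}
    (hz : z ∈ G) {ω : BondConfig (Site d)} (hvz : ω ∈ openConnIn (↑(box d N) : Set (Site d)) v z) :
    (G.filter fun z' => ω ∈ openConnIn (↑(box d N) : Set (Site d)) v z') ⊆
      (GM.ball z N).filter fun w => ω ∈ openConnIn (↑(GM.ball z (4 * N)) : Set (Site d)) z w := by
  intro z' hz'
  obtain ⟨hz'G, hvz'⟩ := Finset.mem_filter.1 hz'
  have hza := hGa hz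
  have hz'a := hGa hz'G
  refine Finset.mem_filter.2 ⟨?_, ?_⟩
  · rw [← sub_mem_box_iff_mem_ball, mem_box]
    intro i
    have h1 := (mem_box.1 hza) i
    have h2 := (mem_box.1 hz'a) i
    simp only [Pi.sub_apply]
    constructor <;> omega
  · rw [DCT16.mem_openConnIn_iff_pathIn] at hvz hvz' ⊢
    have hsub : (↑(box d N) : Set (Site d)) ⊆ ↑(GM.ball z (4 * N)) := by
      intro w hw
      rw [Finset.mem_coe, ← sub_mem_box_iff_mem_ball, mem_box]
      intro i
      have h1 := (mem_box.1 (Finset.mem_coe.1 hw)) i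
      have h2 := (mem_box.1 hza) i
      simp only [Pi.sub_apply]
      constructor <;> push_cast <;> omega
    exact (hvz.symm.trans hvz').mono hsub

open Classical in
/-- **Many sites of `Λ(a)` are fat and have an arm** (`2a ≤ N`): if some `v` has at least `t` sites `z ∈ G = {v ∈ Λ(a) : armEvent v M}` with
`v ↔ z in Λ(N)`, then at least `t` sites `z ∈ Λ(a)` satisfy `armEvent z M ∩ FAT(z, N, t)`. [cite: Kesten1986, Thm. (8)] -/
theorem le_card_filter_armEvent_inter_fat_of_le {a N M : ℕ} (haN : 2 * a ≤ N) {t : ℝ} {v : Site d} {ω : BondConfig (Site d)}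
    (F : Site d → Set (BondConfig (Site d)))
    (hF : ∀ z, F z = DCT16.armEvent z M ∩
        {ω : BondConfig (Site d) | t ≤ (((GM.ball z N).filter fun w =>
          ω ∈ (openConnIn (↑(GM.ball z (4 * N)) : Set (Site d)) z w : Set (BondConfig (Site d)))).card : ℝ)})
    (ht : t ≤ ((((box d a).filter fun v => ω ∈ DCT16.armEvent v M).filter fun z =>
          ω ∈ openConnIn (↑(box d N) : Set (Site d)) v z).card : ℝ)) :
    t ≤ (((box d a).filter fun z => ω ∈ F z).card : ℝ) := by
  classical
  set G := (box d a).filter fun v => ω ∈ DCT16.armEvent v M with hG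
  have hGa : G ⊆ box d a := Finset.filter_subset _ _
  refine ht.trans ?_
  exact_mod_cast Finset.card_le_card (fun z hz => by
    obtain ⟨hzG, hvz⟩ := Finset.mem_filter.1 hz
    obtain ⟨hza, hzarm⟩ := Finset.mem_filter.1 hzG
    refine Finset.mem_filter.2 ⟨hza, ?_⟩
    rw [hF z]
    refine ⟨hzarm, ?_⟩
    rw [Set.mem_setOf_eq]
    refine ht.trans ?_
    exact_mod_cast Finset.card_le_card (filter_class_subset_fat_of_le haN G hGa hzG hvz))

/-! ## §4 Re-rooting: translation invariance and Markov for counts -/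

open Classical in
/-- **RE-ROOTING AT A GENERAL ANNULUS** (every `p`; `1 ≤ a`, `2a ≤ N`, `N + a ≤ M`, `1 ≤ k`).  With `Z_a = #{v ∈ Λ(a) : armEvent v M}`,
`N(a,N) = annulusClusterCount d a N` and `t = |Λ(a)| π_p(M) / (2k)`:
`t · (P_p(½|Λ(a)|π_p(M) < Z_a) − P_p(k < N(a,N))) ≤ |Λ(a)| · P_p({0 ↔ ∂ⁱⁿΛ(M)} ∩ FAT(0, N, t))` — the aspect-`N/a` form of
`mul_le_card_mul_real_siteToBoundary_inter_fat` (certification inside `Λ(4N)`). [cite: Kesten1986, Thm. (8)]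
[cite: BorgsChayesKestenSpencer1999, §1 (tightness postulate)] -/
theorem mul_le_card_mul_real_siteToBoundary_inter_fat_of_le (p : unitInterval) {a N M k : ℕ} (ha : 1 ≤ a) (haN : 2 * a ≤ N)
    (haM : N + a ≤ M) (hk : 1 ≤ k) :
    ((box d a).card : ℝ) * oneArmProb d p M / (2 * k) *
        ((bondPercolation (zdGraph d) p).real
            {ω | ((box d a).card : ℝ) * oneArmProb d p M / 2 <
              (((box d a).filter fun v => ω ∈ DCT16.armEvent v M).card : ℝ)} -
          (bondPercolation (zdGraph d) p).real {ω | (k : ℕ∞) < annulusClusterCount d a N ω}) ≤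
      ((box d a).card : ℝ) * (bondPercolation (zdGraph d) p).real (siteToBoundary d M ∩
        {ω : BondConfig (Site d) | ((box d a).card : ℝ) * oneArmProb d p M / (2 * k) ≤
          (((box d N).filter fun w =>
            ω ∈ (openConnIn (↑(box d (4 * N)) : Set (Site d)) (0 : Site d) w : Set (BondConfig (Site d)))).card : ℝ)}) := by
  classical
  set μ := bondPercolation (zdGraph d) p with hμ
  set t : ℝ := ((box d a).card : ℝ) * oneArmProb d p M / (2 * k) with htdef
  set Gz : Site d → Set (BondConfig (Site d)) := fun z => DCT16.armEvent z M ∩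
      {ω : BondConfig (Site d) | t ≤ (((GM.ball z N).filter fun w =>
        ω ∈ (openConnIn (↑(GM.ball z (4 * N)) : Set (Site d)) z w : Set (BondConfig (Site d)))).card : ℝ)} with hGz
  set Ev : Set (BondConfig (Site d)) := {ω | ((box d a).card : ℝ) * oneArmProb d p M / 2 <
      (((box d a).filter fun v => ω ∈ DCT16.armEvent v M).card : ℝ)} with hEv
  set Bad : Set (BondConfig (Site d)) := {ω | (k : ℕ∞) < annulusClusterCount d a N ω} with hBad
  have hk0 : (0 : ℝ) < k := by exact_mod_cast hk
  have ht0 : 0 ≤ t := by rw [htdef]; exact div_nonneg (mul_nonneg (Nat.cast_nonneg _) measureReal_nonneg) (by linarith)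
  -- Markov for counts; the good event forces `t` fat-and-armed sites
  have hmeas : ∀ z ∈ box d a, MeasurableSet (Gz z) := fun z _ =>
    ((determinedBy_armEvent_ball z M).measurableSet_of_finset).inter
      ((determinedBy_fat z N t).measurableSet_of_finset)
  have hkey : t * μ.real (Ev \ Bad) ≤ ∑ z ∈ box d a, μ.real (Gz z) := by
    refine mul_real_le_sum_of_le_real_count μ (box d a) Gz hmeas ht0 ?_
    refine DCT16.real_mono_of_forall_subset_edgeSet (zdGraph d) p fun ω hω h => ?_
    obtain ⟨hωE, hωB⟩ := h
    rw [hEv, Set.mem_setOf_eq] at hωE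
    rw [hBad, Set.mem_setOf_eq, not_lt] at hωB
    have hGne : ((box d a).filter fun v => ω ∈ DCT16.armEvent v M).Nonempty := by
      rw [← Finset.card_pos]
      have h0 : (0 : ℝ) ≤ ((box d a).card : ℝ) * oneArmProb d p M / 2 :=
        div_nonneg (mul_nonneg (Nat.cast_nonneg _) measureReal_nonneg) (by norm_num)
      exact_mod_cast h0.trans_lt hωE
    obtain ⟨v, hvG, hcls⟩ := card_filter_le_mul_card_class_of_le ha haN haM hω hωB hGne
    rw [Set.mem_setOf_eq]
    refine le_card_filter_armEvent_inter_fat_of_le haN (v := v) Gz (fun z => rfl) ?_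
    have hcls' : ((((box d a).filter fun v => ω ∈ DCT16.armEvent v M).card : ℕ) : ℝ) ≤
        (k : ℝ) * ((((box d a).filter fun v => ω ∈ DCT16.armEvent v M).filter fun z =>
          ω ∈ openConnIn (↑(box d N) : Set (Site d)) v z).card : ℝ) := by exact_mod_cast hcls
    rw [htdef, div_le_iff₀ (by linarith)]
    nlinarith [hωE, hcls']
  -- translation invariance
  have hsum : ∑ z ∈ box d a, μ.real (Gz z) = ((box d a).card : ℝ) * μ.real (siteToBoundary d M ∩
      {ω : BondConfig (Site d) | t ≤ (((box d N).filter fun w =>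
        ω ∈ (openConnIn (↑(box d (4 * N)) : Set (Site d)) (0 : Site d) w : Set (BondConfig (Site d)))).card : ℝ)}) := by
    rw [Finset.sum_congr rfl fun z _ => real_armEvent_inter_fat_eq p z M N t, Finset.sum_const, nsmul_eq_mul]
  have hdiff : μ.real Ev - μ.real Bad ≤ μ.real (Ev \ Bad) := by
    have h1 : μ.real Ev ≤ μ.real ((Ev \ Bad) ∪ Bad) := measureReal_mono fun ω hω => by
      by_cases hb : ω ∈ Bad
      · exact Or.inr hb
      · exact Or.inl ⟨hω, hb⟩
    have h2 := measureReal_union_le (μ := μ) (Ev \ Bad) Bad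
    linarith
  calc t * (μ.real Ev - μ.real Bad) ≤ t * μ.real (Ev \ Bad) := mul_le_mul_of_nonneg_left hdiff ht0
    _ ≤ ∑ z ∈ box d a, μ.real (Gz z) := hkey
    _ = _ := hsum

end Rsw3

end Summit.CriticalPhenomena.PercolationContinuityZ3.Theorems
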